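import Literature.NumberTheory.GaloisRepresentations.AdequacyDegreeP
import Literature.NumberTheory.GaloisRepresentations.PicardCurveGaloisRep
import HarnessLib

/-!
# The heart of the permutation module of four points over `𝔽₃` is adequate in the extended sense

Topic `NumberTheory/GaloisRepresentations`; a sibling of `AdequacyDegreeP.lean` (Guralnick–Herzig–Tiep
2017, Thm 1.7 as the named fact `ght2017_adequate_or_index_p_or_psl29`, and its imprimitive case
Prop. 6.6 PROVED there as `Subgroup.isExtendedAdequate_of_lines`) and of `S4BranchModuleAdequate.lean`
(the same instance in ONE explicit matrix model).  Here the instance of Theorem 1.7 that the tree uses —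
`G ↠ S₄` acting on the branch-point module `(𝔽₃^Ω)⁰⁰ = (𝔽₃^Ω)⁰`, `|Ω| = 4`, `p = 3 = dim` — is settled
**basis-free and unconditionally** (no classification of finite simple groups): for EVERY basis `B` of
the tree's `Heart 3 Ω` (`SuperellipticTorsionRep`) and every group `G` acting on `Ω` through all of
`Sym(Ω)`, the matrix group `[heartRep 3 Ω G]_B ≤ GL₃(𝔽₃)` is `Subgroup.IsExtendedAdequate`
(GHT §1 = Thorne, Math. Z. 285 (2017) Def. 2.20).

* § 1 `isExtendedAdequate_range_frameOfBasis_of_lines` — Prop. 6.6 (lines form) for the matrix form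
  `frameOfBasis ρ B` (`SteinbergArtinRep`) of an abstract representation `ρ` with a line-permuted basis
  `b` (transport `b` along `B.equivFun`; `LinearMap.toMatrix_mulVec_repr`);
* § 2 signed indicators `signVec S = 1_S − 1_{Sᶜ} ∈ 𝔽₃^Ω` of `2`-subsets `S` (sum-zero for `|Ω| = 4`),
  `g · signVec S = signVec (g • S)`, `signVec Sᶜ = −signVec S`; labelled pairs `pairSet e i =
  {e⁻¹ 0, e⁻¹ (i+1)}` for `e : Ω ≃ Fin 4` (a `2`-subset of `Ω` or its complement passes through `e⁻¹ 0`);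
* § 3 the pairing basis `pairBasis` of `Heart 3 Ω` (`dim = 3`: `finrank_augmentationSubmodule`,
  `augmentationEquivHeart`; independence by evaluation at the four points) and irreducibility (tree
  `augmentationRep_isIrreducible_of_alternatingGroup_le` through `augmentationRepEquivHeartRep`);
* § 4 `isExtendedAdequate_range_frameOfBasis_heartRep` — `S₄ = V₄ ⋊ S₃` permutes the three pairing
  lines up to sign, `(01)(23)` is `diag(1, −1, −1)` (`A = V₄` non-central), `(01)` fixes `{01|23}` and
  moves `{02|13}` (`|G/A| = 6 ≠ 3`); and `isExtendedAdequate_range_heartRep_toMatrix`, the same for the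
  homomorphism written `Units.map (toMatrixAlgEquiv B) ∘ (heartRep 3 Ω G).asGroupHom` — the shape of
  the framed heart `r̄_f^B : Γ_K → GL₃(𝔽₃)` of a generic Picard curve (crux `MuOrdinaryFamilyRT`, line
  `thorne-minimal-lift`), whose adequacy (`RbarExtendedAdequate`) thereby no longer needs Theorem 1.7.

## References

* [GuralnickHerzigTiep2017] R. Guralnick, F. Herzig, P. H. Tiep, *Adequate subgroups and indecomposable
  modules*, JEMS 19 (2017) 1231–1291 = arXiv:1405.0043, Thm 1.7, Prop. 6.6 (arXiv pp. 4, 20).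
* [Thorne2017TwoAdic] J. Thorne, Math. Z. 285 (2017), Def. 2.20 (the notion of adequacy).
-/

noncomputable section

namespace Literature.NumberTheory.GaloisRepresentations

open scoped Matrix Pointwise
open Literature.RepresentationTheory.Semisimple

universe u v w

/-! ## 1. Proposition 6.6 (lines form) for the matrix form `frameOfBasis ρ B` of a representation -/

section FrameLines

variable {k : Type u} [Field k] {G : Type v} [Group G] {V : Type w} [AddCommGroup V] [Module k V]
  {n : ℕ}

/-- Coordinates intertwine `ρ` with its matrix form: `[ρ g]_B · [v]_B = [ρ g v]_B`. [folklore] -/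
theorem glRepresentation_frameOfBasis_equivFun (ρ : Representation k G V)
    (B : Module.Basis (Fin n) k V) (g : G) (v : V) :
    glRepresentation (frameOfBasis ρ B) g (B.equivFun v) = B.equivFun (ρ g v) := by
  rw [glRepresentation_apply_apply, coe_frameOfBasis_apply, Module.Basis.equivFun_apply,
    Module.Basis.equivFun_apply, LinearMap.toMatrix_mulVec_repr]

/-- The matrix form of an irreducible representation is irreducible on `kⁿ` (coordinates
`B.equivFun : V ≃ kⁿ` are an equivalence of representations). [folklore] -/
theorem isIrreducible_glRepresentation_frameOfBasis (ρ : Representation k G V)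
    (B : Module.Basis (Fin n) k V) (hirr : ρ.IsIrreducible) :
    (glRepresentation (frameOfBasis ρ B)).IsIrreducible :=
  haveI := hirr
  Representation.isIrreducible_of_equiv (k := k) (V := V) (W := Fin n → k)
    (Representation.Equiv.mk (ρ := ρ) (σ := glRepresentation (frameOfBasis ρ B)) B.equivFun fun g =>
      LinearMap.ext fun v => by
        simp only [LinearMap.comp_apply, LinearEquiv.coe_coe, glRepresentation_frameOfBasis_equivFun])

variable {p : ℕ} [Fact p.Prime] [CharP k p]

/-- **GHT Prop. 6.6 (lines form) for an abstract representation.**  Let `ρ : G → GL(V)` be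
irreducible, `dim V = p = char k`, with finite image, and let `b` be a basis of `V` whose lines
`k · b i` are permuted by every `ρ g`; assume some `ρ g` is diagonal along `b` with two distinct
eigenvalues, and some `ρ g` fixes one line of `b` while moving another.  Then for EVERY basis `B`
of `V` the matrix group `[ρ(G)]_B ≤ GL_p(k)` is adequate in the extended sense.  (Transport `b`
along the coordinate isomorphism `B.equivFun` and apply `Subgroup.isExtendedAdequate_of_lines`.)
[cite: GuralnickHerzigTiep2017, Proposition 6.6; Proposition 6.5 (i)] -/
theorem isExtendedAdequate_range_frameOfBasis_of_lines (ρ : Representation k G V)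
    (B : Module.Basis (Fin p) k V) [Finite (frameOfBasis ρ B).range] (hirr : ρ.IsIrreducible)
    (b : Module.Basis (Fin p) k V)
    (hperm : ∀ (g : G) (i : Fin p), ∃ (j : Fin p) (c : k), ρ g (b i) = c • b j)
    (hA : ∃ (g : G) (d : Fin p → k), (∀ i, ρ g (b i) = d i • b i) ∧ ∃ i j, d i ≠ d j)
    (hfix : ∃ (g : G) (i j : Fin p), (∃ c : k, ρ g (b i) = c • b i) ∧
      ∀ c : k, ρ g (b j) ≠ c • b j) :
    Subgroup.IsExtendedAdequate (frameOfBasis ρ B).range := by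
  classical
  set τ := frameOfBasis ρ B with hτ
  have hirr' : (glRepresentation τ.range.subtype).IsIrreducible :=
    isIrreducible_range_subtype τ (isIrreducible_glRepresentation_frameOfBasis ρ B hirr)
  let b' : Module.Basis (Fin p) k (Fin p → k) := b.map B.equivFun
  have hb' : ∀ i, b' i = B.equivFun (b i) := fun i => by simp [b']
  have key : ∀ (g : G) (i : Fin p),
      ((τ g : GL (Fin p) k) : Matrix (Fin p) (Fin p) k) *ᵥ b' i = B.equivFun (ρ g (b i)) := by
    intro g i
    rw [hb', ← glRepresentation_apply_apply, glRepresentation_frameOfBasis_equivFun]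
  refine Subgroup.isExtendedAdequate_of_lines τ.range hirr' b' ?_ ?_ ?_
  · rintro ⟨_, g, rfl⟩ i
    obtain ⟨j, c, hjc⟩ := hperm g i
    refine ⟨j, c, ?_⟩
    change ((τ g : GL (Fin p) k) : Matrix (Fin p) (Fin p) k) *ᵥ b' i = c • b' j
    rw [key, hjc, map_smul, hb']
  · obtain ⟨g, d, hd, i, j, hij⟩ := hA
    refine ⟨⟨τ g, g, rfl⟩, d, fun i => ?_, i, j, hij⟩
    change ((τ g : GL (Fin p) k) : Matrix (Fin p) (Fin p) k) *ᵥ b' i = d i • b' i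
    rw [key, hd, map_smul, hb']
  · obtain ⟨g, i, j, ⟨c, hc⟩, hj⟩ := hfix
    refine ⟨⟨τ g, g, rfl⟩, i, j, ⟨c, ?_⟩, fun c' hc' => hj c' ?_⟩
    · change ((τ g : GL (Fin p) k) : Matrix (Fin p) (Fin p) k) *ᵥ b' i = c • b' i
      rw [key, hc, map_smul, hb']
    · change ((τ g : GL (Fin p) k) : Matrix (Fin p) (Fin p) k) *ᵥ b' j = c' • b' j at hc'
      rw [key, hb', ← map_smul] at hc'
      exact B.equivFun.injective hc'

end FrameLines

/-! ## 2. Signed indicator vectors of `2`-subsets of a `4`-set -/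

namespace HeartFour

section SignVec

variable {Ω : Type v} [Fintype Ω] [DecidableEq Ω]

/-- The signed indicator `1_S − 1_{Ω∖S} ∈ 𝔽₃^Ω` of a subset `S ⊆ Ω`. [folklore] -/
def signVec (S : Finset Ω) : Ω →₀ ZMod 3 :=
  Finsupp.equivFunOnFinite.symm fun x => if x ∈ S then 1 else -1

omit [DecidableEq Ω] in
/-- `(1_S − 1_{Sᶜ})(x) = ±1`. [folklore] -/
@[simp]
theorem signVec_apply [DecidableEq Ω] (S : Finset Ω) (x : Ω) :
    signVec S x = if x ∈ S then 1 else -1 := by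
  simp [signVec]

/-- Complementation negates the signed indicator. [folklore] -/
theorem signVec_compl (S : Finset Ω) : signVec Sᶜ = -signVec S := by
  ext x
  by_cases hx : x ∈ S <;> simp [hx]

/-- Equivariance: `g · (1_S − 1_{Sᶜ}) = 1_{gS} − 1_{(gS)ᶜ}`. [folklore] -/
theorem permRep_signVec {G : Type w} [Group G] [MulAction G Ω] (g : G) (S : Finset Ω) :
    permRep (ZMod 3) G Ω g (signVec S) = signVec (g • S) := by
  ext y
  rw [permRep_apply_apply, signVec_apply, signVec_apply]
  exact if_congr Finset.inv_smul_mem_iff rfl rfl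

/-- `ε(1_S − 1_{Sᶜ}) = |S| − |Sᶜ|`. [folklore] -/
theorem augmentation_signVec (S : Finset Ω) :
    augmentation (ZMod 3) Ω (signVec S) = (S.card : ZMod 3) - (Sᶜ.card : ZMod 3) := by
  rw [augmentation, Finsupp.linearCombination_apply,
    Finsupp.sum_fintype _ (fun _ b => b • (1 : ZMod 3)) (fun _ => zero_smul _ _)]
  simp only [signVec_apply, smul_eq_mul, mul_one]
  rw [Finset.sum_ite, Finset.sum_const, Finset.sum_const, Finset.filter_mem_eq_inter,
    Finset.univ_inter, Finset.filter_not, Finset.filter_mem_eq_inter, Finset.univ_inter,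
    ← Finset.compl_eq_univ_sdiff, nsmul_eq_mul, nsmul_eq_mul, mul_one, mul_neg_one,
    sub_eq_add_neg]

/-- For `|Ω| = 4` and `|S| = 2` the signed indicator is a sum-zero vector. [folklore] -/
theorem signVec_mem (hΩ : Fintype.card Ω = 4) {S : Finset Ω} (hS : S.card = 2) :
    signVec S ∈ augmentationSubmodule (ZMod 3) Ω := by
  rw [mem_augmentationSubmodule_iff, augmentation_signVec, Finset.card_compl, hΩ, hS]
  decide

/-- The signed indicator of `S` as an element of the sum-zero module `(𝔽₃^Ω)⁰` (set to `0` when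
it is not sum-zero; for `|Ω| = 4`, `|S| = 2` it is `1_S − 1_{Sᶜ}`, `coe_pairVec`). [folklore] -/
def pairVec (S : Finset Ω) : augmentationSubmodule (ZMod 3) Ω :=
  haveI := Classical.dec (signVec S ∈ augmentationSubmodule (ZMod 3) Ω)
  if h : signVec S ∈ augmentationSubmodule (ZMod 3) Ω then ⟨signVec S, h⟩ else 0

/-- Unfolding `pairVec` on sum-zero signed indicators. [folklore] -/
theorem coe_pairVec {S : Finset Ω} (h : signVec S ∈ augmentationSubmodule (ZMod 3) Ω) :
    (pairVec S : Ω →₀ ZMod 3) = signVec S := by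
  rw [pairVec, dif_pos h]

/-- Equivariance of `pairVec` on `2`-subsets of a `4`-set. [folklore] -/
theorem augmentationRep_pairVec (hΩ : Fintype.card Ω = 4) {G : Type w} [Group G] [MulAction G Ω]
    (g : G) {S : Finset Ω} (hS : S.card = 2) :
    augmentationRep (ZMod 3) G Ω g (pairVec S) = pairVec (g • S) := by
  apply Subtype.ext
  rw [coe_augmentationRep_apply, coe_pairVec (signVec_mem hΩ hS),
    coe_pairVec (signVec_mem hΩ (by rw [Finset.card_smul_finset, hS])), permRep_signVec]

/-- Complementary pairs give opposite vectors. [folklore] -/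
theorem pairVec_compl (hΩ : Fintype.card Ω = 4) {S : Finset Ω} (hS : S.card = 2) :
    pairVec Sᶜ = -pairVec S := by
  apply Subtype.ext
  rw [Submodule.coe_neg, coe_pairVec (signVec_mem hΩ hS),
    coe_pairVec (signVec_mem hΩ (by rw [Finset.card_compl, hS, hΩ])), signVec_compl]

/-! ### Labelled pairs: `Ω ≃ Fin 4`, the three pairings through the point labelled `0` -/

/-- The pair `{e⁻¹ 0, e⁻¹ (i+1)}`, `i : Fin 3` — one `2`-subset through `e⁻¹ 0` for each of the
three pairings `{0, i+1 | rest}` of the four points. [folklore] -/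
def pairSet (e : Ω ≃ Fin 4) (i : Fin 3) : Finset Ω := {e.symm 0, e.symm i.succ}

omit [Fintype Ω] in
/-- `|{e⁻¹ 0, e⁻¹ (i+1)}| = 2`. [folklore] -/
theorem card_pairSet (e : Ω ≃ Fin 4) (i : Fin 3) : (pairSet e i).card = 2 :=
  Finset.card_pair fun h => Fin.succ_ne_zero i (e.symm.injective h).symm

omit [Fintype Ω] in
/-- Membership of a labelled point in a labelled pair. [folklore] -/
theorem mem_pairSet_iff (e : Ω ≃ Fin 4) (i : Fin 3) (m : Fin 4) :
    e.symm m ∈ pairSet e i ↔ m = 0 ∨ m = i.succ := by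
  simp [pairSet, e.symm.injective.eq_iff]

omit [Fintype Ω] in
/-- A `2`-subset through `e⁻¹ 0` is one of the three `pairSet e i`. [folklore] -/
theorem exists_eq_pairSet (e : Ω ≃ Fin 4) {T : Finset Ω} (hT : T.card = 2) (h0 : e.symm 0 ∈ T) :
    ∃ i : Fin 3, T = pairSet e i := by
  have key : ∀ z : Ω, z ≠ e.symm 0 → ∃ i : Fin 3, z = e.symm i.succ := by
    intro z hz
    have hz0 : e z ≠ 0 := fun h => hz (by rw [← h, Equiv.symm_apply_apply])
    exact ⟨(e z).pred hz0, by rw [Fin.succ_pred, Equiv.symm_apply_apply]⟩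
  obtain ⟨x, y, hxy, rfl⟩ := Finset.card_eq_two.1 hT
  simp only [Finset.mem_insert, Finset.mem_singleton] at h0
  rcases h0 with hx | hy
  · obtain ⟨i, hi⟩ := key y (hx ▸ Ne.symm hxy)
    exact ⟨i, by rw [pairSet, ← hx, hi]⟩
  · obtain ⟨i, hi⟩ := key x (hy ▸ hxy)
    exact ⟨i, by rw [pairSet, ← hy, hi, Finset.pair_comm]⟩

omit [Fintype Ω] in
/-- The image of a labelled pair under `g` acting through `e⁻¹ ∘ π ∘ e`. [folklore] -/
theorem smul_pair_eq {G : Type w} [Group G] [MulAction G Ω] (e : Ω ≃ Fin 4) {g : G}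
    {π : Equiv.Perm (Fin 4)} (hg : MulAction.toPermHom G Ω g = (e.trans π).trans e.symm)
    (i j : Fin 4) :
    g • ({e.symm i, e.symm j} : Finset Ω) = {e.symm (π i), e.symm (π j)} := by
  have hgx : ∀ x, g • x = e.symm (π (e x)) := fun x => by
    have := congrArg (fun σ : Equiv.Perm Ω => σ x) hg
    simpa using this
  rw [Finset.smul_finset_insert, Finset.smul_finset_singleton, hgx, hgx, Equiv.apply_symm_apply,
    Equiv.apply_symm_apply]

omit [Fintype Ω] in
/-- The image of the `i`-th pairing pair under `g` acting through `e⁻¹ ∘ π ∘ e`. [folklore] -/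
theorem smul_pairSet_eq {G : Type w} [Group G] [MulAction G Ω] (e : Ω ≃ Fin 4) {g : G}
    {π : Equiv.Perm (Fin 4)} (hg : MulAction.toPermHom G Ω g = (e.trans π).trans e.symm)
    (i : Fin 3) :
    g • pairSet e i = {e.symm (π 0), e.symm (π i.succ)} :=
  smul_pair_eq e hg 0 i.succ

/-- Complementary labelled pairs: `{e⁻¹ i, e⁻¹ j}` is the complement of the `l`-th pairing pair
when `{i, j} = {0, l+1}ᶜ` in `Fin 4`. [folklore] -/
theorem pair_eq_compl_pairSet (e : Ω ≃ Fin 4) {i j : Fin 4} {l : Fin 3}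
    (h : ∀ m : Fin 4, (m = i ∨ m = j) ↔ ¬ (m = 0 ∨ m = l.succ)) :
    ({e.symm i, e.symm j} : Finset Ω) = (pairSet e l)ᶜ := by
  ext x
  obtain ⟨m, rfl⟩ := e.symm.surjective x
  simp only [pairSet, Finset.mem_insert, Finset.mem_singleton, Finset.mem_compl,
    e.symm.injective.eq_iff]
  exact h m

/-- The three signed indicators `1_{0,i+1} − 1_{rest}` are linearly independent in `𝔽₃^Ω`.
[folklore] -/
theorem linearIndependent_signVec_pairSet (e : Ω ≃ Fin 4) :
    LinearIndependent (ZMod 3) fun i : Fin 3 => signVec (pairSet e i) := by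
  rw [Fintype.linearIndependent_iff]
  intro g hg
  have hval : ∀ m : Fin 4,
      ∑ i : Fin 3, g i * (if m = 0 ∨ m = i.succ then (1 : ZMod 3) else -1) = 0 := by
    intro m
    have := congrArg (fun f : Ω →₀ ZMod 3 => f (e.symm m)) hg
    simpa only [Finsupp.coe_finsetSum, Finset.sum_apply, Finsupp.coe_smul, Pi.smul_apply,
      signVec_apply, mem_pairSet_iff, smul_eq_mul, Finsupp.coe_zero, Pi.zero_apply] using this
  simp only [Fin.sum_univ_three] at hval
  have key : ∀ a b c : ZMod 3,
      (∀ m : Fin 4, a * (if m = 0 ∨ m = (0 : Fin 3).succ then (1 : ZMod 3) else -1) +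
          b * (if m = 0 ∨ m = (1 : Fin 3).succ then (1 : ZMod 3) else -1) +
          c * (if m = 0 ∨ m = (2 : Fin 3).succ then (1 : ZMod 3) else -1) = 0) →
        a = 0 ∧ b = 0 ∧ c = 0 := by
    decide
  obtain ⟨h0, h1, h2⟩ := key (g 0) (g 1) (g 2) hval
  intro i
  fin_cases i
  · exact h0
  · exact h1
  · exact h2

end SignVec

/-! ## 3. The heart of four points: pairing basis, irreducibility, adequacy -/

section HeartFour

variable {Ω : Type v} [Fintype Ω] [DecidableEq Ω]

omit [DecidableEq Ω] in
/-- `3 ∤ 4`. [folklore] -/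
theorem not_three_dvd_card (hΩ : Fintype.card Ω = 4) : ¬ 3 ∣ Fintype.card Ω := by
  rw [hΩ]; decide

omit [DecidableEq Ω] in
/-- `dim_{𝔽₃} (𝔽₃^Ω)⁰⁰ = 3` for `|Ω| = 4` (the heart is the sum-zero hyperplane, `3 ∤ 4`).
[folklore] -/
theorem finrank_heart_of_card_eq_four (hΩ : Fintype.card Ω = 4) :
    Module.finrank (ZMod 3) (Heart 3 Ω) = 3 := by
  haveI : Nonempty Ω := Fintype.card_pos_iff.1 (by omega)
  rw [← (augmentationEquivHeart 3 Ω (not_three_dvd_card hΩ)).finrank_eq,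
    finrank_augmentationSubmodule, Nat.card_eq_fintype_card, hΩ]

/-- **The heart of four points is irreducible** under any `G` acting on `Ω` through all of
`Sym(Ω)` (tree: `augmentationRep_isIrreducible_of_alternatingGroup_le`, transported along
`augmentationRepEquivHeartRep`). [folklore] -/
theorem heartRep_isIrreducible_of_card_eq_four (hΩ : Fintype.card Ω = 4) {G : Type w} [Group G]
    [MulAction G Ω] (hG : Function.Surjective (MulAction.toPermHom G Ω)) :
    (heartRep 3 Ω G).IsIrreducible := by
  haveI := augmentationRep_isIrreducible_of_alternatingGroup_le (k := ZMod 3) (G := G) (X := Ω)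
    (by decide) hΩ (by rw [MonoidHom.range_eq_top.2 hG]; exact le_top)
  exact Representation.isIrreducible_of_equiv (k := ZMod 3) (V := augmentationSubmodule (ZMod 3) Ω)
    (W := Heart 3 Ω) (augmentationRepEquivHeartRep 3 Ω (not_three_dvd_card hΩ) G)

/-- The heart vector `[1_{0,i+1} − 1_{rest}] ∈ (𝔽₃^Ω)⁰⁰` of the `i`-th pairing. [folklore] -/
def pairHeart (e : Ω ≃ Fin 4) (i : Fin 3) : Heart 3 Ω :=
  Submodule.Quotient.mk (pairVec (pairSet e i))

/-- The three pairing vectors of the heart are linearly independent (lift to `𝔽₃^Ω` along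
`augmentationEquivHeart`). [folklore] -/
theorem linearIndependent_pairHeart (hΩ : Fintype.card Ω = 4) (e : Ω ≃ Fin 4) :
    LinearIndependent (ZMod 3) (pairHeart e) := by
  have h34 := not_three_dvd_card hΩ
  let L : Heart 3 Ω →ₗ[ZMod 3] (Ω →₀ ZMod 3) :=
    (augmentationSubmodule (ZMod 3) Ω).subtype ∘ₗ (augmentationEquivHeart 3 Ω h34).symm.toLinearMap
  refine LinearIndependent.of_comp L ?_
  have hL : L ∘ pairHeart e = fun i => signVec (pairSet e i) := by
    funext i
    simp only [Function.comp_apply, L, LinearMap.comp_apply, LinearEquiv.coe_coe, pairHeart]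
    rw [show Submodule.Quotient.mk (pairVec (pairSet e i)) =
        augmentationEquivHeart 3 Ω h34 (pairVec (pairSet e i)) from
        (augmentationEquivHeart_apply 3 Ω h34 _).symm, LinearEquiv.symm_apply_apply,
      Submodule.subtype_apply, coe_pairVec (signVec_mem hΩ (card_pairSet e i))]
  rw [hL]
  exact linearIndependent_signVec_pairSet e

/-- **The pairing basis** of the heart of four points: `[1_{0,i+1} − 1_{rest}]`, `i : Fin 3`.
[folklore] -/
noncomputable def pairBasis (hΩ : Fintype.card Ω = 4) (e : Ω ≃ Fin 4) :
    Module.Basis (Fin 3) (ZMod 3) (Heart 3 Ω) :=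
  basisOfLinearIndependentOfCardEqFinrank (linearIndependent_pairHeart hΩ e)
    (by rw [Fintype.card_fin, finrank_heart_of_card_eq_four hΩ])

/-- The `i`-th pairing basis vector is `[pairVec (pairSet e i)]`. [folklore] -/
theorem pairBasis_apply (hΩ : Fintype.card Ω = 4) (e : Ω ≃ Fin 4) (i : Fin 3) :
    pairBasis hΩ e i = Submodule.Quotient.mk (pairVec (pairSet e i)) := by
  rw [pairBasis, coe_basisOfLinearIndependentOfCardEqFinrank]; rfl

/-- How `g` moves the pairing basis: `g · u_i = [pairVec (g • pairSet e i)]`. [folklore] -/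
theorem heartRep_pairBasis (hΩ : Fintype.card Ω = 4) (e : Ω ≃ Fin 4) {G : Type w} [Group G]
    [MulAction G Ω] (g : G) (i : Fin 3) :
    heartRep 3 Ω G g (pairBasis hΩ e i) = Submodule.Quotient.mk (pairVec (g • pairSet e i)) := by
  rw [pairBasis_apply, heartRep_mk, augmentationRep_pairVec hΩ g (card_pairSet e i)]

end HeartFour

end HeartFour

/-! ## 4. The theorem -/

section Main

open HeartFour

variable {Ω : Type v} [Fintype Ω] {G : Type w} [Group G] [MulAction G Ω]

/-- **The heart of four points over `𝔽₃` is adequate in the extended sense** (GHT 2017 Thm 1.7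
for `S₄` on `𝔽₃⁴/Δ`, settled by its imprimitive case Prop. 6.6, no classification of finite
simple groups): for `|Ω| = 4`, any group `G` acting on `Ω` through ALL of `Sym(Ω) ≅ S₄`, and ANY
basis `B` of the heart `(𝔽₃^Ω)⁰⁰ = (𝔽₃^Ω)⁰` (`3 ∤ 4`), the matrix group
`[heartRep(G)]_B ≤ GL₃(𝔽₃)` is extended-adequate.  Proof: `S₄ = V₄ ⋊ S₃` permutes the three
pairing lines `[1_{0,i} − 1_{rest}]` up to sign (a `2`-subset of `Ω` or its complement contains the
point `0`); `(01)(23)` is diagonal `(1, −1, −1)`; `(01)` fixes the pairing `{01|23}` and moves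
`{02|13}` to `{03|12}`; irreducibility is the tree's (`A₄ ⊆` image).  This is the residual image
of Thorne's minimal-lifting hypothesis for generic Picard curves (`r̄_f^B`, crux
`MuOrdinaryFamilyRT`), for every frame `B`.
[cite: GuralnickHerzigTiep2017, Proposition 6.6 (instance); Theorem 1.7] -/
theorem isExtendedAdequate_range_frameOfBasis_heartRep (hΩ : Fintype.card Ω = 4)
    (hG : Function.Surjective (MulAction.toPermHom G Ω))
    (B : Module.Basis (Fin 3) (ZMod 3) (Heart 3 Ω)) :
    Subgroup.IsExtendedAdequate (frameOfBasis (heartRep 3 Ω G) B).range := by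
  classical
  obtain ⟨e⟩ : Nonempty (Ω ≃ Fin 4) := ⟨Fintype.equivFinOfCardEq hΩ⟩
  refine isExtendedAdequate_range_frameOfBasis_of_lines (p := 3) (heartRep 3 Ω G) B
    (heartRep_isIrreducible_of_card_eq_four hΩ hG) (pairBasis hΩ e) ?_ ?_ ?_
  · -- every `g` permutes the three pairing lines up to sign
    intro g i
    have hT2 : (g • pairSet e i).card = 2 := by rw [Finset.card_smul_finset, card_pairSet]
    rw [heartRep_pairBasis hΩ e g i]
    by_cases ha : e.symm 0 ∈ g • pairSet e i
    · obtain ⟨j, hj⟩ := exists_eq_pairSet e hT2 ha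
      exact ⟨j, 1, by rw [hj, one_smul, pairBasis_apply]⟩
    · have hTc2 : (g • pairSet e i)ᶜ.card = 2 := by rw [Finset.card_compl, hT2, hΩ]
      obtain ⟨j, hj⟩ := exists_eq_pairSet e hTc2 (Finset.mem_compl.2 ha)
      have hneg : pairVec (g • pairSet e i) = -pairVec (pairSet e j) := by
        have := pairVec_compl hΩ hTc2
        rwa [compl_compl, hj] at this
      exact ⟨j, -1, by rw [hneg, Submodule.Quotient.mk_neg, neg_one_smul, pairBasis_apply]⟩
  · -- `(01)(23)` is diagonal `(1, −1, −1)` along the pairing basis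
    obtain ⟨g, hg⟩ := hG ((e.trans (Equiv.swap 0 1 * Equiv.swap 2 3)).trans e.symm)
    set π : Equiv.Perm (Fin 4) := Equiv.swap 0 1 * Equiv.swap 2 3 with hπ
    have hπ0 : π 0 = Fin.succ 0 := by decide
    have hπ1 : π (Fin.succ 0) = 0 := by decide
    have hπ2 : π (Fin.succ 1) = 3 := by decide
    have hπ3 : π (Fin.succ 2) = 2 := by decide
    refine ⟨g, fun i => if i = 0 then 1 else -1, fun i => ?_, 0, 1, by decide⟩
    fin_cases i
    · show heartRep 3 Ω G g (pairBasis hΩ e 0) =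
        (if (0 : Fin 3) = 0 then (1 : ZMod 3) else -1) • pairBasis hΩ e 0
      rw [if_pos rfl, heartRep_pairBasis hΩ e g 0, smul_pairSet_eq e hg 0, one_smul, pairBasis_apply,
        hπ0, hπ1, Finset.pair_comm]
      rfl
    · show heartRep 3 Ω G g (pairBasis hΩ e 1) =
        (if (1 : Fin 3) = 0 then (1 : ZMod 3) else -1) • pairBasis hΩ e 1
      rw [if_neg (show ¬ ((1 : Fin 3) = 0) by decide), heartRep_pairBasis hΩ e g 1,
        smul_pairSet_eq e hg 1, hπ0, hπ2,
        pair_eq_compl_pairSet e (i := Fin.succ 0) (j := 3) (l := 1) (by decide),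
        pairVec_compl hΩ (card_pairSet e 1), Submodule.Quotient.mk_neg, neg_one_smul, pairBasis_apply]
    · show heartRep 3 Ω G g (pairBasis hΩ e 2) =
        (if (2 : Fin 3) = 0 then (1 : ZMod 3) else -1) • pairBasis hΩ e 2
      rw [if_neg (show ¬ ((2 : Fin 3) = 0) by decide), heartRep_pairBasis hΩ e g 2,
        smul_pairSet_eq e hg 2, hπ0, hπ3,
        pair_eq_compl_pairSet e (i := Fin.succ 0) (j := 2) (l := 2) (by decide),
        pairVec_compl hΩ (card_pairSet e 2), Submodule.Quotient.mk_neg, neg_one_smul, pairBasis_apply]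
  · -- `(01)` fixes the pairing `{01|23}` and moves `{02|13}` (to `{03|12}`)
    obtain ⟨g, hg⟩ := hG ((e.trans (Equiv.swap 0 1)).trans e.symm)
    set π : Equiv.Perm (Fin 4) := Equiv.swap 0 1 with hπ
    have hπ0 : π 0 = Fin.succ 0 := by decide
    have hπ1 : π (Fin.succ 0) = 0 := by decide
    have hπ2 : π (Fin.succ 1) = Fin.succ 1 := by decide
    refine ⟨g, 0, 1, ⟨1, ?_⟩, fun c hc => ?_⟩
    · rw [heartRep_pairBasis hΩ e g 0, smul_pairSet_eq e hg 0, one_smul, pairBasis_apply, hπ0, hπ1,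
        Finset.pair_comm]
      rfl
    · rw [heartRep_pairBasis hΩ e g 1, smul_pairSet_eq e hg 1, hπ0, hπ2,
        pair_eq_compl_pairSet e (i := Fin.succ 0) (j := Fin.succ 1) (l := 2) (by decide),
        pairVec_compl hΩ (card_pairSet e 2), Submodule.Quotient.mk_neg, ← pairBasis_apply hΩ e 2] at hc
      -- `-u₂ = c • u₁` is impossible for a basis
      have h := congrArg (fun v => (pairBasis hΩ e).repr v 2) hc
      simp only [map_neg, map_smul, Module.Basis.repr_self, Finsupp.coe_neg, Finsupp.coe_smul,
        Pi.neg_apply, Pi.smul_apply, Finsupp.single_eq_same, Finsupp.single_apply,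
        show ((1 : Fin 3) = 2) ↔ False from iff_false_intro (by decide), if_false, smul_eq_mul,
        mul_zero] at h
      exact absurd h (by decide)

/-- **The same, for the matrix form written with `LinearMap.toMatrixAlgEquiv`** (the shape of the
tree's `rbar f B : Γ_K → GL₃(𝔽₃)` for the branch-point module of a Picard curve, which is this
homomorphism for `Ω = Roots f`, `G = Γ_K`, by `rfl`): the image is extended-adequate for every
basis `B`, unconditionally. [cite: GuralnickHerzigTiep2017, Proposition 6.6 (instance); Theorem 1.7] -/
theorem isExtendedAdequate_range_heartRep_toMatrix (hΩ : Fintype.card Ω = 4)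
    (hG : Function.Surjective (MulAction.toPermHom G Ω))
    (B : Module.Basis (Fin 3) (ZMod 3) (Heart 3 Ω)) :
    Subgroup.IsExtendedAdequate
      ((Units.map (LinearMap.toMatrixAlgEquiv B).toRingEquiv.toMonoidHom).comp
        (heartRep 3 Ω G).asGroupHom).range := by
  have h : (Units.map (LinearMap.toMatrixAlgEquiv B).toRingEquiv.toMonoidHom).comp
      (heartRep 3 Ω G).asGroupHom = frameOfBasis (heartRep 3 Ω G) B :=
    MonoidHom.ext fun g => Units.ext rfl
  rw [h]
  exact isExtendedAdequate_range_frameOfBasis_heartRep hΩ hG B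

/-- **Specialisation to the full symmetric group `Sym(Ω)` itself.** [cite: GuralnickHerzigTiep2017, Proposition 6.6 (instance)] -/
theorem isExtendedAdequate_range_frameOfBasis_heartRep_perm (hΩ : Fintype.card Ω = 4)
    (B : Module.Basis (Fin 3) (ZMod 3) (Heart 3 Ω)) :
    Subgroup.IsExtendedAdequate (frameOfBasis (heartRep 3 Ω (Equiv.Perm Ω)) B).range :=
  isExtendedAdequate_range_frameOfBasis_heartRep hΩ
    (fun σ => ⟨σ, Equiv.ext fun x => by simp⟩) B

end Main

end Literature.NumberTheory.GaloisRepresentations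

end
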